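import Summits.QuantumFields.YangMills.Theorems.BalabanUVNodesN12TowerGuardsOfClass
import Literature.MathematicalPhysics.QuantumFieldTheory.Balaban1983to89.Node00.MultiScaleFibreChartB
import HarnessLib

/-!
# DAG node N12 [B15] — THE PER-TOWER (0.4) GUARDS OF A (2.12)-CLASS CONFIGURATION AND OF THE PULL-BACK DATUM (LOCATED-E1-HSB repair step (r2)): at every constrained bond `(j, c)` — **BOND-DATUM EDITION** (`…N12TowerGuardsOfClassB`, USED DECLARATIONS ONLY)

The print-datum ([Balaban1984PropagatorsII] (2.3)) (γ) twin of `Summits/…/Theorems/BalabanUVNodesN12TowerGuardsOfClass.lean`: the declarations of the parent whose STATEMENT reads the determining datum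
(`guardOn_towerRegion_Bj_of_mem_class`) and which N12's junction of record v14ᴸ uses (dag-n12-c g35 probe-2 census `UsedConstsN12RoadTyped2`, THEOREMS block), re-typed over a
BOND-LEVEL datum `𝔅 : BDetSet` (F0a `B15DeterminingSetsB`) and dag-n12-c's bond-datum chart `Node00.msChartB` (✓p774329; `msChart 𝐁 = msChartB (bondsDet 𝐁)` by `rfl`).  GENERATOR twin
(this seat's `work/g32/gen_thm.py`, block-extracted from the parent's tree bytes): namespace `…N12TowerGuardsOfClassB`, SAME short names, `DetSet ↦ BDetSet`, `AgreeOn 𝐁 ↦ AgreeOnB 𝔅`,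
`IsMinimizer ↦ IsMinimizerB`, `bondsOf (𝐁 j) ↦ 𝔅 j`, `msChart ∕ constrCard ∕ constrEnum ∕ ConstrSet ↦ …B`, NODE 00 chart lemmas `…msChart… ↦ …msChartB…`; proofs VERBATIM; the parent's
datum-free declarations REUSED BY NAME (`open`), never copied (private plumbing excepted, №366 R2).  The parent's (b) statements are the instances `𝔅 := bondsDet 𝐁`.

Cell `pub-ymgap` (HUMAN RULINGS D-0062 ∕ D-0149), seat `pub-ymgap-dag-n12-d` g32 (R134 N12 [B15] s2; the (ii) Theorems-side re-key of N12's road at print's [II] (2.3) datum — director-ym №338 ∕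
№343 (E1)(iii-b), FLAG №16 ∕ ruling (α); dag-n12-c DESIGN memo a793b2ebc0b803bf (ii); `N12-ROAD-TWIN-ORDER-2026-08-30.md`).  Count-neutral helper of K1⁹ `stmt-QuantumFields-27364`,
`--kind proof --supports … --as helper`.  THEOREMS ONLY (0 `def`, 0 `instance`, 0 `sorry`).

HONEST FRAMING (director-ym №338 (5)).  PURELY ADDITIVE: the parent stays landed and true on its own text; nothing in it is edited; no displayed premise of any consumer is deleted or
weakened; every hypothesis of the parent stays a hypothesis.  Nothing of Bałaban's analysis asserted; N12 NOT discharged; K0⁷ ∕ K1⁹ NOT closed; counts unmoved (typed 28∕28 · discharged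
8∕27, A 8∕28; K 1∕4); one finite 𝕋⁴ programme at fixed ε — R4 closes the conditional rung `BalabanLadder.UV` only; NOT the Yang–Mills mass gap (Clay); nothing continuum ∕ ℝ⁴ ∕ OS.

PARENT's DOCSTRING (the mathematics and the citations; read the site-level `𝐁` as the bond datum `𝔅`):
# DAG node N12 [B15] — THE PER-TOWER (0.4) GUARDS OF A (2.12)-CLASS CONFIGURATION AND OF THE PULL-BACK DATUM (LOCATED-E1-HSB repair step (r2)): at every constrained bond `(j, c)`
# of `𝐁_k(Z)` the configuration `U₀` ITSELF is (0.4)-guarded along the tower of `c` — no proxy, no global `SmallBelow` — as soon as `U₀` lies in the (2.12) class of record; and so is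
# ANY configuration plaquette-small on the tower box, in particular the datum `Q_k^{s*}V` wherever `V` is plaquette-small at scale `k`

[Balaban1985Variational] = «[15]», (2) p. 278, (82)–(83) p. 290, Prop. 9 (190) p. 309; [Balaban1988Convergent] = «[III]», (2.2) p. 255, (2.10)–(2.13) pp. 256–257;
[Balaban1987RG1] = «[I]», (0.4) p. 253, (0.21) p. 256; [BalabanImbrieJaffe1985] (4.5.3) p. 312; [Balaban1989LargeFieldI] = «[IV]», (1.74) p. 192, p. 193 ll. 14–20.

Cell `pub-ymgap`, HUMAN RULINGS D-0062 ∕ D-0149, lane owner `pub-ymgap-dag-n12-c` (g24).  Key K1⁹ `stmt-QuantumFields-27364`, `--kind proof --supports … --as helper`; count-neutral.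
COMMISSIONED: plan g91 YMPLAN WORD N12 LOCATED-E1-HSB (pub-ymgap INBOX l.45435, 2026-08-29) «(r1)+(r2) to the lane».  NEW leaf; CONSUMED BY NAME, nothing modified: this lane's ρ5b
`N12TowerProxiesOfClass` (`exists_boxProxy_of_plaqSmallOn`, `exists_towerProxy_of_mem_class_pos`, `feeds_subset_boxBonds`, `towerBox_lt_sitesPerDir`), step (r2)'s Literature leaf
`B15AveragingHolomorphicTowerRegion` (guard transfer `guardOn_towerRegion_of_feedsProxy`, `guardOn_towerRegion_zero`) and g11's `B15Prop1DatumSmall7AtZSequence.plaqSmallOn_qsstarGIter0_of_isBlockUnion`.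

WHY (lane memo `N12-UNIFORMITY-SPEC.md` §6).  N12's only undischarged node-level input (J0′) `hMin` has a producer in the tree (w1 lineage, `…MinimiserFamilyFromThm1AtBaseCentral`) that
displays, per base field, the two GLOBAL (0.4) guards `hsbQ : SmallBelow k (Q_k^{s*}(ext V_k))`, `hsbU : SmallBelow k U₀` — false for data rough off `Z`.  Step (r1) (`B15AveragingHolomorphicLocal`)
showed the implicit-function argument needs the guard only along the TOWER of each constrained bond; this file INHABITS those tower guards: for `U₀` from its (2.12) class (ρ5b's axial-gauge
tower proxies, transferred to `U₀` itself by two-block locality), and for any configuration plaquette-small on the tower box — the datum `Q_k^{s*}V` being so wherever `V` is plaquette-small on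
the `k`-blocks holding the box (`plaqSmallOn_qsstarGIter0_of_isBlockUnion`, [IV] p. 193 ll. 14–16).  These are the replacement texts for `hsbU` ∕ `hsbQ` in the additive «TP» twins of step (r3).

CONTENTS (namespace `Summit.QuantumFields.YangMills.BalabanUVNodes.N12TowerGuardsOfClass`; theorems only — no `def`, no `instance`, no `sorry`).
* §1 ★★ `guardOn_towerRegion_of_plaqSmallOn_towerBox` — class-free core: ANY `SU(N)` configuration `δ`-plaquette-small on a set containing the tower box plaquettes of a level-`j` bond
  (`1 ≤ j ≤ k`, `k + 1 ≤ m + K`), with the height's radius letter `hsbU` and the budget `(d−1)(6Lʲ−4)·δ ≤ ρ″`, is (0.4)-guarded along the tower of that bond below `j`.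
* §2 ★★★ `guardOn_towerRegion_of_mem_class_pos` · ★★★ `guardOn_towerRegion_bondsOf_Bj_of_mem_class` (`bondsOf` currency) · ★★★ `guardOn_towerRegion_Bj_of_mem_class` (enumerated) — every constrained bond `(j_i, c_i)` of `𝐁_k(Z)`: the tower guard of a configuration
  `U₀ ∈ U_k({Ω_j(Z)}, εreg)` ITSELF (ρ5b's displayed rows VERBATIM: `4L ≤ M₁`, `k + 1 ≤ m + K`, `LᵏM₁ ∣ 2L^{m+K}`, `0 ≤ εreg`, radius letter `hsbU`, floor `6(d−1)L·εreg ≤ ρ″`).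
* §3 ★★ `guardOn_towerRegion_qsstarGIter0_of_plaqSmallOn` — the DATUM: `V` `δ`-plaquette-small on `plaqsInside Y^{(k)}`, `Y` a union of `k`-blocks holding the four corners of the tower
  box plaquettes (`2 ≤ d`, `0 < δ`), radius letter and budget ⇒ the tower guard of `Q_k^{s*}V` at the bond.

HONEST FRAMING ∕ LOCATED.  Lattice bookkeeping and kernel calculus over landed modules; the radius `ρ″` is an ∃-constant per height (`Node00.exists_uniform_chartCurvature_sq_bound`, displayed as
the letter `hsbU`), the floors volume-free smallness conditions; the geometry placing the datum's tower boxes inside the `k`-blocks where `V` is regular is DISPLAYED (`hbox`), not proved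
here; the re-threading (r3) of the nine-file chart chain is NOT done here; nothing of Bałaban's asserted; count-neutral helper; N12 NOT discharged; K1⁹ NOT closed; counts unmoved; one
finite 𝕋⁴ programme at fixed ε — R4 closes the conditional finite-𝕋⁴ rung `BalabanLadder.UV` only; NOT continuum ∕ OS ∕ mass gap ∕ Clay.
-/

noncomputable section

open scoped BigOperators Matrix.Norms.L2Operator Topology

namespace Summit.QuantumFields.YangMills.BalabanUVNodes.N12TowerGuardsOfClassB

open Literature.MathematicalPhysics.QuantumFieldTheory.Balaban1983to89.B15DeterminingSetsB

open Literature.MathematicalPhysics.QuantumFieldTheory.Balaban1983to89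
open T4Continuum (T4Family)
open B15DeterminingSets
open B14.Eq213MaximalDomains (side)
open B14.Eq213DetSet (Bj maxDomT)
open B14.Eq22Determines (blockIter IsBlockUnion)
open B14.Eq216Concrete (feeds)
open B10Eq42TorusConstraint (bondsIn)
open B15Prop1Carrier (plaqsInside)
open BlockAveraging (Small blockAvg)
open ExpMeanLog (expMeanLogSU)
open T4AxialGaugeSmallField (boxPlaqs boxBonds)
open T4ReflectionCone (three_le_L)
open Node00 (Stage7Numerics SU coeField SmallBelow avOfRecord regMSCoPOfRecord constrCardB constrEnumB)
open Literature.MathematicalPhysics.QuantumFieldTheory.BalabanImbrieJaffe1984to88.BIJ85Eq453GaugeField (qsstarGIter0)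
open B15AveragingHolomorphicTowerRegion (guardOn_towerRegion_of_feedsProxy guardOn_towerRegion_zero)
open B15Prop1DatumSmall7AtZSequence (plaqSmallOn_qsstarGIter0_of_isBlockUnion)
open Summit.QuantumFields.YangMills.BalabanUVNodes.N12TowerProxiesOfClass
  (exists_boxProxy_of_plaqSmallOn exists_towerProxy_of_mem_class_pos feeds_subset_boxBonds towerBox_lt_sitesPerDir)
open Summit.QuantumFields.YangMills.BalabanUVNodes.N12TowerGuardsOfClass (guardOn_towerRegion_bondsOf_Bj_of_mem_class)

section
variable {F : T4Family} {N : ℕ} [NeZero N]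

/-- ★★★ **THE SAME, ENUMERATED** (`Node00.constrEnumB` currency, the index of the datum coordinates `κ`): for every `i : Fin (constrCardB (𝐁_k(Z)) k)` the tower guard of `U₀` at the
constrained bond `(j_i, c_i) = (constrEnumB …).symm i`. [cite: Balaban1985Variational, (2) p.278, Prop. 9 (190) p.309; Balaban1988Convergent, (2.2) p.255, (2.10)–(2.13) pp.256–257; Balaban1987RG1, (0.4) p.253] -/
theorem guardOn_towerRegion_lamBondsSeq_of_mem_class (ν : Stage7Numerics) (Kt : ℕ) {k : ℕ} (Z : Set (Site (F.P Kt) 0))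
    (hkK : k + 1 ≤ (F.P Kt).m + (F.P Kt).K) (hM4 : 4 * (F.P Kt).L ≤ ν.M₁) (hdiv : side (F.P Kt).L ν.M₁ k ∣ (F.P Kt).sitesPerDir 0)
    (hε : 0 ≤ ν.εreg) {ρ'' : ℝ} (hsbU : ∀ V : GaugeField (F.P Kt) 0 (SU N), ‖coeField V - 1‖ ≤ ρ'' → SmallBelow (avOfRecord F N Kt) k V)
    (hερ : 6 * ((((F.P Kt).d - 1 : ℕ)) : ℝ) * (F.P Kt).L * ν.εreg ≤ ρ'')
    {U₀ : GaugeField (F.P Kt) 0 (SU N)} (hU₀ : U₀ ∈ regMSCoPOfRecord F N ν Kt k (maxDomT ν.M₁ Z)) :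
    ∀ i : Fin (constrCardB (lamBondsSeq (maxDomT ν.M₁ Z) k) k), ∀ j', j' < (((constrEnumB (lamBondsSeq (maxDomT ν.M₁ Z) k) k).symm i).1 : ℕ) →
      ∀ c' : PBond (F.P Kt) (j' + 1),
        c' ∈ bondsIn (j' + 1) (blockIter (((constrEnumB (lamBondsSeq (maxDomT ν.M₁ Z) k) k).symm i).1 : ℕ)
          ⁻¹' ({((constrEnumB (lamBondsSeq (maxDomT ν.M₁ Z) k) k).symm i).2.1.src, ((constrEnumB (lamBondsSeq (maxDomT ν.M₁ Z) k) k).symm i).2.1.tgt} :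
            Set (Site (F.P Kt) ((constrEnumB (lamBondsSeq (maxDomT ν.M₁ Z) k) k).symm i).1))) →
          Small expMeanLogSU (Averaging.iter (avOfRecord F N Kt) j' U₀) c' := fun i =>
  guardOn_towerRegion_bondsOf_Bj_of_mem_class ν Kt Z hkK hM4 hdiv hε hsbU hερ hU₀ _
    (Nat.le_of_lt_succ ((constrEnumB (lamBondsSeq (maxDomT ν.M₁ Z) k) k).symm i).1.2) _ (lamBondsSeq_subset_bondsOf_genSet _ _ _ ((constrEnumB (lamBondsSeq (maxDomT ν.M₁ Z) k) k).symm i).2.2)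

end

end Summit.QuantumFields.YangMills.BalabanUVNodes.N12TowerGuardsOfClassB

end
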